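import Mathlib.Topology.Sheaves.Flasque
import Mathlib.Topology.Sheaves.Abelian
import Mathlib.Topology.NoetherianSpace
import Mathlib.CategoryTheory.Generator.Abelian
import Mathlib.CategoryTheory.Abelian.GrothendieckCategory.Coseparator
import Mathlib.CategoryTheory.Abelian.GrothendieckAxioms.Colim
import Mathlib.CategoryTheory.Limits.Constructions.EpiMono
import Mathlib.CategoryTheory.Sites.SheafCohomology.Basic
import Mathlib.CategoryTheory.Abelian.GrothendieckCategory.HasExt
import Mathlib.Algebra.Homology.DerivedCategory.Ext.ExactSequences
import Literature.AlgebraicGeometry.Motives.FlasqueCohomology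
import Literature.AlgebraicGeometry.Motives.DirectedColimits
import HarnessLib

/-!
# Cohomology of filtered direct limits of sheaves on a noetherian space vanishes when it does termwise
# (Hartshorne III.2.9, vanishing form)

Topic: `Literature/AlgebraicGeometry/Motives` (support file for `GrothendieckVanishing.lean`, fourth link
of the chain of results of Hartshorne, *Algebraic Geometry*, III.2 leading to Grothendieck's vanishing
theorem III.2.7).

Setting. `X : TopCat.{u}` noetherian; sheaves of abelian groups are the objects of
`Sheaf (Opens.grothendieckTopology X) AddCommGrpCat.{u}`; `A` is a small filtered category and
`F : A ⥤ Sheaf _ AddCommGrpCat` a direct system with colimit cocone `c`; `Hⁿ(X, ·)` is Mathlib's `Sheaf.H`.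

Main result: `subsingleton_H_succ_of_isColimit` — if `Hⁿ⁺¹(X, ℱ_a) = 0` for all `a`, then
`Hⁿ⁺¹(X, lim→ ℱ_a) = 0`. This is the consequence of **Hartshorne III.2.9** (`lim→ Hⁱ(X, ℱ_a) ≅
Hⁱ(X, lim→ ℱ_a)` on a noetherian space) used in the proof of III.2.7, and it is proved along the lines
of the printed proof of III.2.9, replacing flasque resolutions by dimension shifting: embed the system
functorially into injective sheaves `ℱ_a ↪ 𝒢_a := ∏_{ℱ_a ⟶ E} E`
(`exists_functorial_injective_embedding`; `E` an injective coseparator of the Grothendieck abelian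
category of abelian sheaves), so that `0 → lim→ ℱ_a → lim→ 𝒢_a → lim→ 𝒬_a → 0` is exact
(AB5, Mathlib's `colim.exact_mapShortComplex`) with `lim→ 𝒢_a` flasque (injectives are flasque,
III.2.4, and III.2.8 `isFlasque_of_isColimit`), hence acyclic (III.2.5); in degree one conclude with the
sections of `lim→ 𝒬_a` on a noetherian space (II Ex. 1.11, `exists_rep_of_isColimit`) and
`H¹` as the cokernel of `Γ(𝒢) → Γ(𝒬)` (`subsingleton_H_one_iff_surjective`); in higher degrees shift
to the system `(𝒬_a)` and use induction.

## References

* R. Hartshorne, *Algebraic Geometry*, GTM 52, Springer (1977), doi:10.1007/978-1-4757-3849-0,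
  III.2, Prop. 2.9, p. 209. [Hartshorne1977]
-/

open CategoryTheory Limits Opposite TopologicalSpace

universe v' u' u

namespace Literature.AlgebraicGeometry.Motives

/-! ### The functorial embedding `A ↪ ∏_{A ⟶ E} E` into a power of an injective coseparator -/

section CoseparatorPower

variable {C : Type u'} [Category.{v'} C]

/-- If `E` is an injective coseparator of a category `C` with the products `∏_{A ⟶ E} E`, there is a
functorial embedding of every object into an injective object: a functor `Φ : C ⥤ C` with injective
values (`Φ A = ∏_{f : A ⟶ E} E`, a morphism `u : A ⟶ B` sending the factor indexed by `g : B ⟶ E` to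
the factor indexed by `u ≫ g`) and a natural transformation `𝟭 C ⟶ Φ` (component at `f` equal to
`f`) which is a monomorphism at every object. [folklore] -/
theorem exists_functorial_injective_embedding (E : C) [∀ A : C, HasProduct fun _ : A ⟶ E => E]
    [Injective E] (hE : IsCoseparator E) :
    ∃ (Φ : C ⥤ C) (φ : 𝟭 C ⟶ Φ), (∀ A, Injective (Φ.obj A)) ∧ ∀ A, Mono (φ.app A) := by
  refine ⟨{ obj := fun A => ∏ᶜ fun _ : A ⟶ E => E
            map := fun {A B} u => Pi.lift fun g : B ⟶ E => Pi.π (fun _ : A ⟶ E => E) (u ≫ g)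
            map_id := fun A => Pi.hom_ext _ _ fun g => by
              simp only [Pi.lift_π, Category.id_comp]
            map_comp := fun {A B D} u v => Pi.hom_ext _ _ fun g => by
              simp only [Pi.lift_π, Category.assoc] },
          { app := fun A => Pi.lift fun f : A ⟶ E => f
            naturality := fun {A B} u => Pi.hom_ext _ _ fun g => by
              change (u ≫ Pi.lift fun f => f) ≫ Pi.π (fun _ => E) g =
                ((Pi.lift fun f => f) ≫ Pi.lift fun g => Pi.π (fun _ : A ⟶ E => E) (u ≫ g)) ≫
                  Pi.π _ g
              simp only [Category.assoc, Pi.lift_π] },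
          fun A => (inferInstance : Injective (∏ᶜ fun _ : A ⟶ E => E)),
          fun A => (isCoseparator_iff_mono E).mp hE A⟩

end CoseparatorPower

/-! ### Hartshorne III.2.9 (vanishing form) -/

section

variable {X : TopCat.{u}}


/-- A functorial embedding `ℱ ↪ Φ ℱ` of abelian sheaves into injective abelian sheaves (from an
injective coseparator of the Grothendieck abelian category of abelian sheaves, via
`exists_functorial_injective_embedding`). [folklore] -/
theorem exists_functorial_injective_embedding_sheaf :
    ∃ (Φ : Sheaf (Opens.grothendieckTopology X) AddCommGrpCat.{u} ⥤
        Sheaf (Opens.grothendieckTopology X) AddCommGrpCat.{u}) (φ : 𝟭 _ ⟶ Φ),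
      (∀ G, Injective (Φ.obj G)) ∧ ∀ G, Mono (φ.app G) := by
  obtain ⟨E, hEinj, hE⟩ :=
    Abelian.has_injective_coseparator (separator (Sheaf (Opens.grothendieckTopology X) AddCommGrpCat))
      (isSeparator_separator _)
  exact exists_functorial_injective_embedding E hE

variable [NoetherianSpace X]

/-- **Hartshorne III.2.9** (vanishing form, positive degrees written `n + 1`): on a noetherian
topological space, if `(ℱ_a)` is a filtered direct system of abelian sheaves with
`Hⁿ⁺¹(X, ℱ_a) = 0` for all `a`, then `Hⁿ⁺¹(X, lim→ ℱ_a) = 0`. Proof as printed (effaceability by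
a functorial flasque embedding): embed the system functorially `ℱ_a ↪ 𝒢_a := ∏_{ℱ_a ⟶ E} E` into
injective (hence flasque, III.2.4) sheaves, `E` an injective cogenerator; the quotients `𝒬_a` form
a direct system and `0 → lim→ ℱ_a → lim→ 𝒢_a → lim→ 𝒬_a → 0` is exact (AB5), with `lim→ 𝒢_a`
flasque (III.2.8); conclude by the long exact cohomology sequences, II Ex. 1.11 (sections of
`lim→` on a noetherian space) in degree one, and induction on `n`.
[cite: Hartshorne1977, III.2.9] -/
theorem subsingleton_H_succ_of_isColimit {A : Type u} [SmallCategory A] [IsFiltered A]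
    (F : A ⥤ Sheaf (Opens.grothendieckTopology X) AddCommGrpCat.{u}) {c : Cocone F}
    (hc : IsColimit c) (n : ℕ) (h : ∀ a, Subsingleton ((F.obj a).H (n + 1))) :
    Subsingleton (c.pt.H (n + 1)) := by
  induction n generalizing F c with
  | zero => 
    -- the functorial embedding into injective (hence flasque) sheaves and its cokernel
    obtain ⟨Φ, φ₁, hΦ, hφ₁⟩ := exists_functorial_injective_embedding_sheaf (X := X)
    let φ : F ⟶ F ⋙ Φ := { app := fun a => φ₁.app (F.obj a)
                           naturality := fun a b f => φ₁.naturality (F.map f) }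
    haveI : ∀ a, Mono (φ.app a) := fun a => hφ₁ _
    haveI : Mono φ := NatTrans.mono_of_mono_app φ
    let S := ShortComplex.cokernelSequence φ
    have hS : S.ShortExact :=
      { exact := ShortComplex.cokernelSequence_exact φ
        mono_f := inferInstanceAs (Mono φ) }
    haveI : Mono S.f := inferInstanceAs (Mono φ)
    have hSa : ∀ a, (S.map ((evaluation A _).obj a)).ShortExact := fun a =>
      hS.map_of_exact ((evaluation A _).obj a)
    -- the colimit sequence
    let f : c.pt ⟶ colimit (F ⋙ Φ) := hc.map (colimit.cocone _) S.f
    let g : colimit (F ⋙ Φ) ⟶ colimit S.X₃ := colimMap S.g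
    have hf : ∀ a, c.ι.app a ≫ f = S.f.app a ≫ (colimit.cocone (F ⋙ Φ)).ι.app a :=
      fun a => hc.ι_map _ _ a
    have hg : ∀ a, (colimit.cocone (F ⋙ Φ)).ι.app a ≫ g =
        S.g.app a ≫ (colimit.cocone S.X₃).ι.app a := fun a => ι_colimMap S.g a
    let T := colim.mapShortComplex S hc (colimit.cocone (F ⋙ Φ)) (colimit.cocone S.X₃) f g hf hg
    haveI : ∀ a, Epi (S.g.app a) := fun a => (hSa a).epi_g
    have hT : T.ShortExact :=
      { exact := colim.exact_mapShortComplex hS.exact hc (colimit.isColimit _) (colimit.isColimit _)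
          f g hf hg
        mono_f := colim.map_mono' S.f hc (colimit.isColimit _) f hf
        epi_g := colim.map_epi' S.g _ (colimit.isColimit _) g hg }
    haveI : ∀ a, TopCat.Sheaf.IsFlasque ((F ⋙ Φ).obj a) := fun a =>
      @isFlasque_of_injective _ _ (hΦ _)
    haveI : TopCat.Sheaf.IsFlasque T.X₂ := isFlasque_of_isColimit (F ⋙ Φ) (colimit.isColimit _)
    haveI : Subsingleton (T.X₂.H 1) := subsingleton_H_of_isFlasque _ 1 one_pos
    refine (subsingleton_H_one_iff_surjective hT).mpr fun t => ?_
    obtain ⟨a, ta, hta⟩ := exists_rep_of_isColimit S.X₃ (colimit.isColimit _) (op ⊤) t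
    haveI : Injective (S.map ((evaluation A _).obj a)).X₂ := hΦ _
    haveI : Subsingleton ((S.map ((evaluation A _).obj a)).X₁.H 1) := h a
    obtain ⟨ua, hua⟩ := (subsingleton_H_one_iff_surjective (hSa a)).mp inferInstance ta
    refine ⟨((colimit.cocone (F ⋙ Φ)).ι.app a).hom.app (op ⊤) ua, ?_⟩
    change (((colimit.cocone (F ⋙ Φ)).ι.app a) ≫ g).hom.app (op ⊤) ua = t
    rw [hg a]
    change ((colimit.cocone S.X₃).ι.app a).hom.app (op ⊤) ((S.g.app a).hom.app (op ⊤) ua) = t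
    exact (congr_arg _ hua).trans hta
  | succ n ih => 
    obtain ⟨Φ, φ₁, hΦ, hφ₁⟩ := exists_functorial_injective_embedding_sheaf (X := X)
    let φ : F ⟶ F ⋙ Φ := { app := fun a => φ₁.app (F.obj a)
                           naturality := fun a b f => φ₁.naturality (F.map f) }
    haveI : ∀ a, Mono (φ.app a) := fun a => hφ₁ _
    haveI : Mono φ := NatTrans.mono_of_mono_app φ
    let S := ShortComplex.cokernelSequence φ
    have hS : S.ShortExact :=
      { exact := ShortComplex.cokernelSequence_exact φ
        mono_f := inferInstanceAs (Mono φ) }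
    haveI : Mono S.f := inferInstanceAs (Mono φ)
    have hSa : ∀ a, (S.map ((evaluation A _).obj a)).ShortExact := fun a =>
      hS.map_of_exact ((evaluation A _).obj a)
    let f : c.pt ⟶ colimit (F ⋙ Φ) := hc.map (colimit.cocone _) S.f
    let g : colimit (F ⋙ Φ) ⟶ colimit S.X₃ := colimMap S.g
    have hf : ∀ a, c.ι.app a ≫ f = S.f.app a ≫ (colimit.cocone (F ⋙ Φ)).ι.app a :=
      fun a => hc.ι_map _ _ a
    have hg : ∀ a, (colimit.cocone (F ⋙ Φ)).ι.app a ≫ g =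
        S.g.app a ≫ (colimit.cocone S.X₃).ι.app a := fun a => ι_colimMap S.g a
    let T := colim.mapShortComplex S hc (colimit.cocone (F ⋙ Φ)) (colimit.cocone S.X₃) f g hf hg
    haveI : ∀ a, Epi (S.g.app a) := fun a => (hSa a).epi_g
    have hT : T.ShortExact :=
      { exact := colim.exact_mapShortComplex hS.exact hc (colimit.isColimit _) (colimit.isColimit _)
          f g hf hg
        mono_f := colim.map_mono' S.f hc (colimit.isColimit _) f hf
        epi_g := colim.map_epi' S.g _ (colimit.isColimit _) g hg }
    haveI : ∀ a, TopCat.Sheaf.IsFlasque ((F ⋙ Φ).obj a) := fun a =>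
      @isFlasque_of_injective _ _ (hΦ _)
    haveI : TopCat.Sheaf.IsFlasque T.X₂ := isFlasque_of_isColimit (F ⋙ Φ) (colimit.isColimit _)
    haveI : Subsingleton (T.X₂.H (n + 2)) := subsingleton_H_of_isFlasque _ _ (Nat.succ_pos _)
    -- induction hypothesis for the system of cokernels
    have h3 : ∀ a, Subsingleton ((S.X₃.obj a).H (n + 1)) := fun a => by
      haveI : Injective (S.map ((evaluation A _).obj a)).X₂ := hΦ _
      haveI : Subsingleton ((S.map ((evaluation A _).obj a)).X₁.H (n + 2)) := h a
      exact Ext.subsingleton_X₃ _ (hSa a) (n + 1)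
    haveI : Subsingleton (T.X₃.H (n + 1)) := ih S.X₃ (colimit.isColimit _) h3
    exact Ext.subsingleton_X₁ _ hT (n + 1)

end

end Literature.AlgebraicGeometry.Motives
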